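import Summits.KontsevichZagierPeriods.KontsevichZagierPeriods.Theses.SymplecticScissors

/-!
# `RealOnePeriodRelations` (stmt-KontsevichZagierPeriods-10042), line `nash-retraction-thin-strip`:
# stub `stub_arcSymbols`, auxiliary file 5 — algebra and calculus of the Puiseux flattening

Elementary facts used by the flattening step `x = p + σ C s^q` of the piece reduction:

* `exists_flattenPoly`: for `P ∈ ℚ̄[x, y]` (real algebraic coefficients), `p, C ∈ ℚ̄ ∩ ℝ`,
  `σ = ±1`, `q ≥ 1`, the polynomial `G(s, y) = Σ_e a_e (p + σCs^q)^{e₀} y^{e₁} λ(s)^{d − e₁}`,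
  `λ(s) = qC s^{q−1}`, `d = deg_y P`, has algebraic coefficients and satisfies
  `G(s, λ(s)·Y) = λ(s)^d · P(p + σCs^q, Y)` and `λ(s)·∂_yG(s, λ(s)Y) = λ(s)^d · ∂_yP(p + σCs^q, Y)`
  (all polynomial algebra is done over the subring `𝔸 = integralClosure ℚ ℝ` of real algebraic
  numbers, so that the coefficients produced are algebraic);
* `isAlgebraic_iteratedDeriv_pow_mul`: if `φ` is analytic at `0` with algebraic Taylor coefficients,
  so is `s ↦ s^N φ(s)` (Leibniz rule);
* two one-line limits at `0⁺`.

References: J. Bochnak, M. Coste, M.-F. Roy, *Real Algebraic Geometry* (1998), §8.1; folklore.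
-/

noncomputable section

open scoped BigOperators Topology
open Set Filter MvPolynomial

namespace Summit.KontsevichZagierPeriods.SymplecticScissors.RealOnePeriodRelations

namespace ArcSymbols

/-! ## The `y`-derivative of a two-variable polynomial -/

/-- The `y`-derivative of `y ↦ P(s, y)` for a two-variable polynomial over a subring of `ℝ` is
`∂₁P(s, y)` (adapted from `CurvePeriodsTransfer.stub_etaleShift`, private lemma). [folklore] -/
theorem hasDerivAt_aeval_snd {A : Type*} [CommRing A] [Algebra A ℝ]
    (P : MvPolynomial (Fin 2) A) (s y : ℝ) :
    HasDerivAt (fun t => aeval ![s, t] P) (aeval ![s, y] (pderiv 1 P)) y := by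
  induction P using MvPolynomial.induction_on with
  | C c => simpa [pderiv_C] using hasDerivAt_const y (algebraMap A ℝ c)
  | add p q hp hq => simpa using hp.fun_add hq
  | mul_X p i hp =>
    have h10 : pderiv 1 (X 0 : MvPolynomial (Fin 2) A) = 0 := pderiv_X_of_ne (by decide)
    revert i
    refine Fin.forall_fin_two.2 ⟨?_, ?_⟩
    · have e1 : (fun t : ℝ => aeval ![s, t] (p * X 0)) = fun t => aeval ![s, t] p * s := by
        funext t; simp
      have e2 : aeval ![s, y] (pderiv 1 (p * X 0)) = aeval ![s, y] (pderiv 1 p) * s := by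
        rw [pderiv_mul, h10, mul_zero, add_zero, map_mul, aeval_X]; rfl
      rw [e1, e2]
      exact hp.mul_const s
    · have e1 : (fun t : ℝ => aeval ![s, t] (p * X 1)) = fun t => aeval ![s, t] p * t := by
        funext t; simp
      have e2 : aeval ![s, y] (pderiv 1 (p * X 1)) =
          aeval ![s, y] (pderiv 1 p) * y + aeval ![s, y] p * 1 := by
        rw [pderiv_mul, pderiv_X_self, map_add, map_mul, map_mul, map_one, aeval_X]; rfl
      rw [e1, e2]
      exact hp.fun_mul (hasDerivAt_id y)

/-! ## The flattened polynomial -/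

/-- **The flattened polynomial.** For `P` with real algebraic coefficients, algebraic `p`, `C`,
`σ = ±1` and `q ≥ 1` there is `G ∈ ℚ̄[s, y]` with `G(s, λ(s)Y) = λ(s)^d P(p + σCs^q, Y)` and
`λ(s)∂_yG(s, λ(s)Y) = λ(s)^d ∂_yP(p + σCs^q, Y)`, `λ(s) = qCs^{q−1}`, for some `d`
(namely `G = Σ_e a_e (p + σCs^q)^{e₀} y^{e₁} λ^{d−e₁}`, `d = deg_y P`). [cite: BochnakCosteRoy1998, §8.1] -/
theorem exists_flattenPoly (P : MvPolynomial (Fin 2) ℝ) (hP : ∀ e, IsAlgebraic ℚ (P.coeff e))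
    (p C σ : ℝ) (q : ℕ) (hp : IsAlgebraic ℚ p) (hCa : IsAlgebraic ℚ C) (hσ : σ = 1 ∨ σ = -1) :
    ∃ (G : MvPolynomial (Fin 2) ℝ) (d : ℕ), (∀ e, IsAlgebraic ℚ (G.coeff e)) ∧
      (∀ s Y : ℝ, MvPolynomial.eval ![s, (q * C * s ^ (q - 1)) * Y] G =
        (q * C * s ^ (q - 1)) ^ d * MvPolynomial.eval ![p + σ * C * s ^ q, Y] P) ∧
      (∀ s Y : ℝ, (q * C * s ^ (q - 1)) * MvPolynomial.eval ![s, (q * C * s ^ (q - 1)) * Y]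
          (MvPolynomial.pderiv 1 G) =
        (q * C * s ^ (q - 1)) ^ d * MvPolynomial.eval ![p + σ * C * s ^ q, Y]
          (MvPolynomial.pderiv 1 P)) := by
  classical
  -- coefficients: the subring `𝔸` of real algebraic numbers
  have memA : ∀ x : ℝ, IsAlgebraic ℚ x → x ∈ integralClosure ℚ ℝ := fun x hx => hx.isIntegral
  have algA : ∀ x : integralClosure ℚ ℝ, IsAlgebraic ℚ (x : ℝ) := fun x =>
    isAlgebraic_iff_isIntegral.2 x.2
  obtain ⟨PA, rfl⟩ : ∃ PA : MvPolynomial (Fin 2) (integralClosure ℚ ℝ),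
      map (algebraMap (integralClosure ℚ ℝ) ℝ) PA = P := by
    refine Set.mem_range.1 (mem_range_map_iff_coeffs_subset.2 fun c hc => ?_)
    obtain ⟨n, -, rfl⟩ := mem_coeffs_iff.1 hc
    exact ⟨⟨_, memA _ (hP n)⟩, rfl⟩
  have hσa : IsAlgebraic ℚ σ := by
    rcases hσ with h | h <;> rw [h]
    · exact isAlgebraic_one
    · exact isAlgebraic_one.neg
  set pA : integralClosure ℚ ℝ := ⟨p, memA _ hp⟩ with hpA
  set cA : integralClosure ℚ ℝ := ⟨σ * C, memA _ (hσa.mul hCa)⟩ with hcA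
  set lA : integralClosure ℚ ℝ := ⟨q * C, memA _ ((isAlgebraic_nat q).mul hCa)⟩ with hlA
  set d : ℕ := PA.degreeOf 1 with hd
  set GA : MvPolynomial (Fin 2) (integralClosure ℚ ℝ) := ∑ e ∈ PA.support,
    MvPolynomial.C (PA.coeff e) * (MvPolynomial.C pA + MvPolynomial.C cA * X 0 ^ q) ^ (e 0) *
      X 1 ^ (e 1) * (MvPolynomial.C lA * X 0 ^ (q - 1)) ^ (d - e 1) with hGA
  -- the first identity over `𝔸`
  have hid1 : ∀ s Y : ℝ, aeval ![s, (q * C * s ^ (q - 1)) * Y] GA =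
      (q * C * s ^ (q - 1)) ^ d * aeval ![p + σ * C * s ^ q, Y] PA := by
    intro s Y
    have hR : aeval ![p + σ * C * s ^ q, Y] PA = ∑ e ∈ PA.support,
        (algebraMap (integralClosure ℚ ℝ) ℝ) (PA.coeff e) * ((p + σ * C * s ^ q) ^ (e 0) * Y ^ (e 1)) := by
      rw [MvPolynomial.aeval_def, MvPolynomial.eval₂_eq']
      refine Finset.sum_congr rfl fun e _ => ?_
      rw [Fin.prod_univ_two]
      rfl
    rw [hR, hGA, map_sum, Finset.mul_sum]
    refine Finset.sum_congr rfl fun e he => ?_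
    have hle : e 1 ≤ d := monomial_le_degreeOf 1 he
    simp only [map_mul, map_pow, map_add, aeval_C, aeval_X, Matrix.cons_val_zero, Matrix.cons_val_one,
      Matrix.cons_val_fin_one, Subalgebra.algebraMap_apply, hpA, hcA, hlA]
    have hpow : (q * C * s ^ (q - 1) * Y) ^ (e 1) * (q * C * s ^ (q - 1)) ^ (d - e 1) =
        (q * C * s ^ (q - 1)) ^ d * Y ^ (e 1) := by
      rw [mul_pow, mul_assoc, mul_comm (Y ^ (e 1)), ← mul_assoc, ← pow_add, Nat.add_sub_cancel' hle]
    calc ((PA.coeff e : integralClosure ℚ ℝ) : ℝ) * (p + σ * C * s ^ q) ^ (e 0) *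
          (q * C * s ^ (q - 1) * Y) ^ (e 1) * (q * C * s ^ (q - 1)) ^ (d - e 1)
        = ((PA.coeff e : integralClosure ℚ ℝ) : ℝ) * (p + σ * C * s ^ q) ^ (e 0) *
          ((q * C * s ^ (q - 1) * Y) ^ (e 1) * (q * C * s ^ (q - 1)) ^ (d - e 1)) := by ring
      _ = (q * C * s ^ (q - 1)) ^ d * (((PA.coeff e : integralClosure ℚ ℝ) : ℝ) *
          ((p + σ * C * s ^ q) ^ (e 0) * Y ^ (e 1))) := by
          rw [hpow]; ring
  -- the second identity: differentiate the first in `Y`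
  have hid2 : ∀ s Y : ℝ, (q * C * s ^ (q - 1)) * aeval ![s, (q * C * s ^ (q - 1)) * Y] (pderiv 1 GA) =
      (q * C * s ^ (q - 1)) ^ d * aeval ![p + σ * C * s ^ q, Y] (pderiv 1 PA) := by
    intro s Y
    have h1 : HasDerivAt (fun Y => aeval ![s, (q * C * s ^ (q - 1)) * Y] GA)
        (aeval ![s, (q * C * s ^ (q - 1)) * Y] (pderiv 1 GA) * (q * C * s ^ (q - 1))) Y := by
      have hin : HasDerivAt (fun Y => (q * C * s ^ (q - 1)) * Y) (q * C * s ^ (q - 1)) Y := by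
        simpa using (hasDerivAt_id Y).const_mul (q * C * s ^ (q - 1))
      exact (hasDerivAt_aeval_snd GA s _).comp Y hin
    have h2 : HasDerivAt (fun Y => aeval ![s, (q * C * s ^ (q - 1)) * Y] GA)
        ((q * C * s ^ (q - 1)) ^ d * aeval ![p + σ * C * s ^ q, Y] (pderiv 1 PA)) Y := by
      rw [show (fun Y => aeval ![s, (q * C * s ^ (q - 1)) * Y] GA) =
          fun Y => (q * C * s ^ (q - 1)) ^ d * aeval ![p + σ * C * s ^ q, Y] PA from funext (hid1 s)]
      exact (hasDerivAt_aeval_snd PA _ Y).const_mul _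
    linear_combination h1.unique h2
  refine ⟨map (algebraMap (integralClosure ℚ ℝ) ℝ) GA, d, fun e => ?_, fun s Y => ?_, fun s Y => ?_⟩
  · rw [coeff_map, Subalgebra.algebraMap_apply]; exact algA _
  · rw [eval_map, eval_map, ← aeval_def, ← aeval_def]; exact hid1 s Y
  · rw [pderiv_map, pderiv_map, eval_map, eval_map, ← aeval_def, ← aeval_def]; exact hid2 s Y

/-! ## Taylor coefficients of `s^N φ(s)` -/

/-- If `φ` is analytic at `0` with algebraic Taylor coefficients (iterated derivatives at `0`), then
so is `s ↦ s^N φ(s)` (Leibniz rule: the derivatives of `s^N` at `0` are natural numbers). [folklore] -/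
theorem isAlgebraic_iteratedDeriv_pow_mul {φ : ℝ → ℝ} (hφ : AnalyticAt ℝ φ 0)
    (halg : ∀ n, IsAlgebraic ℚ (iteratedDeriv n φ 0)) (N n : ℕ) :
    IsAlgebraic ℚ (iteratedDeriv n (fun x => x ^ N * φ x) 0) := by
  have hf : ContDiffAt ℝ n (fun x : ℝ => x ^ N) 0 := (contDiff_id.pow N).contDiffAt
  have hg : ContDiffAt ℝ n φ 0 := hφ.contDiffAt.of_le le_top
  rw [iteratedDeriv_fun_mul hf hg]
  refine Finset.sum_induction _ (IsAlgebraic ℚ) (fun _ _ ha hb => ha.add hb) isAlgebraic_zero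
    fun i _ => ((isAlgebraic_nat _).mul ?_).mul (halg _)
  have h : iteratedDeriv i (fun x : ℝ => x ^ N) 0 = ((if i = N then N.factorial else 0 : ℕ) : ℝ) :=
    iteratedDeriv_fun_pow_zero
  rw [h]
  exact isAlgebraic_nat _

/-! ## Two limits at `0⁺` -/

/-- A function continuous at `0` which vanishes on `(0, 1]` vanishes at `0`. [folklore] -/
theorem eq_zero_of_forall_Ioc {F : ℝ → ℝ} (hF : ContinuousAt F 0) (h : ∀ s ∈ Set.Ioc (0 : ℝ) 1, F s = 0) :
    F 0 = 0 := by
  have h1 : Tendsto F (𝓝[>] 0) (𝓝 (F 0)) := hF.tendsto.mono_left nhdsWithin_le_nhds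
  have h2 : Tendsto F (𝓝[>] 0) (𝓝 0) := by
    refine tendsto_const_nhds.congr' ?_
    filter_upwards [Ioo_mem_nhdsGT zero_lt_one] with s hs
    exact (h s ⟨hs.1, hs.2.le⟩).symm
  exact tendsto_nhds_unique h1 h2

/-- `s ↦ s⁻¹` is not integrable on `(0, δ)`, `δ > 0`. [folklore] -/
theorem not_integrableOn_inv_Ioo {δ : ℝ} (hδ : 0 < δ) :
    ¬ MeasureTheory.IntegrableOn (fun s : ℝ => s⁻¹) (Set.Ioo 0 δ) := by
  intro h
  have h' : IntervalIntegrable (fun s : ℝ => s⁻¹) MeasureTheory.volume 0 δ := by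
    rw [intervalIntegrable_iff_integrableOn_Ioo_of_le hδ.le]
    exact h
  rcases intervalIntegrable_inv_iff.1 h' with h0 | h0
  · exact hδ.ne h0
  · exact h0 (by simp [hδ.le])

end ArcSymbols

/-- **Registered anchor `helper_arcSymbols_5`** (`s ↦ s⁻¹` is not integrable on `(0, δ)`).
[folklore] -/
theorem helper_arcSymbols_5 : ∀ (δ : ℝ), 0 < δ → ¬ MeasureTheory.IntegrableOn (fun s : ℝ => s⁻¹) (Set.Ioo 0 δ) :=
  fun _ hδ => ArcSymbols.not_integrableOn_inv_Ioo hδ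

end Summit.KontsevichZagierPeriods.SymplecticScissors.RealOnePeriodRelations

end
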